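import Summits.ValiantsHypothesis.ValiantsHypothesis.Theorems.RigidityForcesSymmetryGrenetFirstOrderRankRigidBorderTu
import Summits.ValiantsHypothesis.ValiantsHypothesis.Theorems.RigidityForcesSymmetryGrenetFirstOrderRankRigidBorderH0
import Summits.ValiantsHypothesis.ValiantsHypothesis.Theorems.RigidityForcesSymmetryGrenetFirstOrderRankRigidFinalModuloII

/-!
# Route RigidityForcesSymmetry — `GrenetFirstOrderRankRigid` (item stmt-ValiantsHypothesis-21029),
line `grenet_gauge`: stub `stub_linearRigid` — the type-II borders and the assembly modulo (D-PQ) of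
type II

For the crux line `Cruxes/GrenetFirstOrderRankRigid/Lines/grenet_gauge.lean` (blueprint
`Lines/grenet_gauge-stub_linearRigid-PROOF.md`, §5, block II, borders; interface `…-BLOCKS.md`).

* `grenet_borderTu` — the binder `hTu` of `grenet_linearRigid_of_blockII`: two genuine tail entries of
  a pair `(univ, T)` in one column agree (all `ρ_y`, `y : Fin n`, are equal: `grenet_borderTu_core`
  compares `ρ_x`, `x ∈ T`, with `ρ_{p'}`, `p' ∉ T`, and `T ≠ ∅`, `T ≠ univ` link everything);
* `grenet_borderH0` — the binder `hH0`: two genuine head entries of a pair `(S, ∅)` in one row agree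
  (`grenet_borderH0_core`, `S ≠ ∅`, `S ≠ univ`);
* `grenet_linearRigid_of_blockII_PQ` — **`stub_linearRigid` for every vertex enumeration `e`, modulo the
  single identity (D-PQ) for the pairs `T ⊊ U` (interior of type II)**, the binder `hII` (granted the
  support condition of the direction).

No new definitions.  VP ≠ VNP is not moved by this file.
-/

noncomputable section

open MvPolynomial Matrix Finset

namespace Summit.ValiantsHypothesis.Theorems.RigidityForcesSymmetry.GrenetGauge

open Literature.Computability.AlgebraicComplexity

variable {k : Type*} [CommRing k] [IsDomain k] {n N : ℕ} (e : Finset (Fin n) ≃ Fin (N + 1))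

/-- **Binder `hTu`: genuine tail entries of a pair `(univ, T)` in one column agree.**
[cite: Grenet2011, Thm. 1] -/
theorem grenet_borderTu (hn : n ≠ 0) (hN : 2 ^ n = N + 1)
    (A' : Fin n × Fin n → Matrix (Fin N) (Fin N) k)
    (htr : ((Grenet.repr k n e).adjugate * ∑ v, (X v : MvPolynomial (Fin n × Fin n) k) • (A' v).map C).trace = 0)
    (hsupp : ∀ (w : Fin n × Fin n) (a b : Fin N), A' w a b ≠ 0 →
      (w.1 ∉ e.symm ((e univ).succAbove a) ∧ (w.2 : ℕ) = (e.symm ((e univ).succAbove a)).card) ∨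
      (w.1 ∈ e.symm ((e ∅).succAbove b) ∧ (e.symm ((e ∅).succAbove b)).card = (w.2 : ℕ) + 1))
    (i j : Fin N) (v : Fin n × Fin n) (i' : Fin N) (v' : Fin n × Fin n)
    (ht : v.1 ∉ e.symm ((e univ).succAbove i) ∧ (v.2 : ℕ) = (e.symm ((e univ).succAbove i)).card)
    (hnh : ¬ (v.1 ∈ e.symm ((e ∅).succAbove j) ∧ (e.symm ((e ∅).succAbove j)).card = (v.2 : ℕ) + 1))
    (ht' : v'.1 ∉ e.symm ((e univ).succAbove i') ∧ (v'.2 : ℕ) = (e.symm ((e univ).succAbove i')).card)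
    (_hnh' : ¬ (v'.1 ∈ e.symm ((e ∅).succAbove j) ∧ (e.symm ((e ∅).succAbove j)).card = (v'.2 : ℕ) + 1))
    (hU : insert v.1 (e.symm ((e univ).succAbove i)) = univ)
    (hU' : insert v'.1 (e.symm ((e univ).succAbove i')) = univ) :
    A' v i j = A' v' i' j := by
  classical
  set T := e.symm ((e ∅).succAbove j) with hTdef
  have hRi : e.symm ((e univ).succAbove i) = univ.erase v.1 := by rw [← Finset.erase_insert ht.1, hU]
  have hRi' : e.symm ((e univ).succAbove i') = univ.erase v'.1 := by rw [← Finset.erase_insert ht'.1, hU']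
  have hn1 : (v.2 : ℕ) = n - 1 := by
    rw [ht.2, hRi, Finset.card_erase_of_mem (Finset.mem_univ _), Finset.card_univ, Fintype.card_fin]
  have hn1' : (v'.2 : ℕ) = n - 1 := by
    rw [ht'.2, hRi', Finset.card_erase_of_mem (Finset.mem_univ _), Finset.card_univ, Fintype.card_fin]
  have hvv : v'.2 = v.2 := Fin.ext (by rw [hn1, hn1'])
  have hTuniv : T ≠ univ := fun h => hnh ⟨by rw [h]; exact Finset.mem_univ _,
    by rw [h, Finset.card_univ, Fintype.card_fin, hn1]; omega⟩
  obtain ⟨x₀, hx₀⟩ := Finset.nonempty_iff_ne_empty.mpr (grenet_col_ne_empty e j)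
  obtain ⟨p₀, hp₀⟩ : ∃ p₀, p₀ ∉ T := by
    by_contra h
    push Not at h
    exact hTuniv (Finset.eq_univ_of_forall h)
  obtain ⟨ix, hix⟩ := exists_grenet_row_eq e (S := univ.erase x₀) fun h =>
    (Finset.erase_eq_self.mp h) (Finset.mem_univ x₀)
  obtain ⟨ip, hip⟩ := exists_grenet_row_eq e (S := univ.erase p₀) fun h =>
    (Finset.erase_eq_self.mp h) (Finset.mem_univ p₀)
  -- every tail entry of the column equals the one at `p₀`
  have key : ∀ (y : Fin n) (iy : Fin N), e.symm ((e univ).succAbove iy) = univ.erase y →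
      A' (y, v.2) iy j = A' (p₀, v.2) ip j := by
    intro y iy hiy
    by_cases hyT : y ∈ T
    · exact (grenet_borderTu_core e hn hN A' htr hsupp hyT hp₀ hiy hip hn1).symm
    · rw [grenet_borderTu_core e hn hN A' htr hsupp hx₀ hyT hix hiy hn1,
        grenet_borderTu_core e hn hN A' htr hsupp hx₀ hp₀ hix hip hn1]
  have e1 := key v.1 i hRi
  have e2 := key v'.1 i' hRi'
  have hv' : v' = (v'.1, v.2) := Prod.ext rfl hvv
  rw [hv']
  exact e1.trans e2.symm

/-- **Binder `hH0`: genuine head entries of a pair `(S, ∅)` in one row agree.**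
[cite: Grenet2011, Thm. 1] -/
theorem grenet_borderH0 (hn : n ≠ 0) (hN : 2 ^ n = N + 1)
    (A' : Fin n × Fin n → Matrix (Fin N) (Fin N) k)
    (htr : ((Grenet.repr k n e).adjugate * ∑ v, (X v : MvPolynomial (Fin n × Fin n) k) • (A' v).map C).trace = 0)
    (hsupp : ∀ (w : Fin n × Fin n) (a b : Fin N), A' w a b ≠ 0 →
      (w.1 ∉ e.symm ((e univ).succAbove a) ∧ (w.2 : ℕ) = (e.symm ((e univ).succAbove a)).card) ∨
      (w.1 ∈ e.symm ((e ∅).succAbove b) ∧ (e.symm ((e ∅).succAbove b)).card = (w.2 : ℕ) + 1))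
    (i j : Fin N) (v : Fin n × Fin n) (j' : Fin N) (v' : Fin n × Fin n)
    (hh : v.1 ∈ e.symm ((e ∅).succAbove j) ∧ (e.symm ((e ∅).succAbove j)).card = (v.2 : ℕ) + 1)
    (hnt : ¬ (v.1 ∉ e.symm ((e univ).succAbove i) ∧ (v.2 : ℕ) = (e.symm ((e univ).succAbove i)).card))
    (hh' : v'.1 ∈ e.symm ((e ∅).succAbove j') ∧ (e.symm ((e ∅).succAbove j')).card = (v'.2 : ℕ) + 1)
    (_hnt' : ¬ (v'.1 ∉ e.symm ((e univ).succAbove i) ∧ (v'.2 : ℕ) = (e.symm ((e univ).succAbove i)).card))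
    (h0 : (e.symm ((e ∅).succAbove j)).erase v.1 = ∅) (h0' : (e.symm ((e ∅).succAbove j')).erase v'.1 = ∅) :
    A' v i j = A' v' i j' := by
  classical
  set S := e.symm ((e univ).succAbove i) with hSdef
  have hCj : e.symm ((e ∅).succAbove j) = {v.1} := by
    rw [← Finset.insert_erase hh.1, h0, Finset.insert_empty]
  have hCj' : e.symm ((e ∅).succAbove j') = {v'.1} := by
    rw [← Finset.insert_erase hh'.1, h0', Finset.insert_empty]
  have hv0 : (v.2 : ℕ) = 0 := by
    have := hh.2; rw [hCj, Finset.card_singleton] at this; omega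
  have hv0' : (v'.2 : ℕ) = 0 := by
    have := hh'.2; rw [hCj', Finset.card_singleton] at this; omega
  have hvv : v'.2 = v.2 := Fin.ext (by rw [hv0, hv0'])
  have hSne : S.Nonempty := by
    rw [Finset.nonempty_iff_ne_empty]
    intro h
    exact hnt ⟨by rw [h]; exact Finset.notMem_empty _, by rw [h, Finset.card_empty, hv0]⟩
  obtain ⟨p₀, hp₀⟩ := hSne
  obtain ⟨x₀, hx₀⟩ : ∃ x₀, x₀ ∉ S := by
    by_contra h
    push Not at h
    exact grenet_row_ne_univ e i (Finset.eq_univ_of_forall h)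
  obtain ⟨jx, hjx⟩ := exists_grenet_col_eq e (S := ({x₀} : Finset (Fin n))) (Finset.singleton_ne_empty _)
  obtain ⟨jp, hjp⟩ := exists_grenet_col_eq e (S := ({p₀} : Finset (Fin n))) (Finset.singleton_ne_empty _)
  -- every head entry of the row equals the one at `p₀`
  have key : ∀ (y : Fin n) (jy : Fin N), e.symm ((e ∅).succAbove jy) = {y} →
      A' (y, v.2) i jy = A' (p₀, v.2) i jp := by
    intro y jy hjy
    by_cases hyS : y ∈ S
    · rw [grenet_borderH0_core e hn hN A' htr hsupp hx₀ hyS hjx hjy hv0,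
        grenet_borderH0_core e hn hN A' htr hsupp hx₀ hp₀ hjx hjp hv0]
    · exact (grenet_borderH0_core e hn hN A' htr hsupp hyS hp₀ hjy hjp hv0).symm
  have e1 := key v.1 j hCj
  have e2 := key v'.1 j' hCj'
  have hv' : v' = (v'.1, v.2) := Prod.ext rfl hvv
  rw [hv']
  exact e1.trans e2.symm

/-- **`stub_linearRigid` modulo the interior of type II.**  For Grenet's pencil (any vertex
enumeration `e`, any integral domain `k`): if (D-PQ) holds for the pairs `T ⊊ U` (binder `hII`, for
every homogeneous tangent direction supported on the tail/head positions), then every direction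
`(Λ', A')` that is Zariski-tangent, tangent to the rank stratum and has a trace-balanced gauge constant
part is a gauge direction.  (`grenet_linearRigid_of_blockII` with `hTu := grenet_borderTu`,
`hH0 := grenet_borderH0`.) [cite: Grenet2011, Thm. 1] -/
theorem grenet_linearRigid_of_blockII_PQ (hn : n ≠ 0) (hN : 2 ^ n = N + 1)
    (hII : ∀ (A' : Fin n × Fin n → Matrix (Fin N) (Fin N) k),
      ((Grenet.repr k n e).adjugate * ∑ v, (X v : MvPolynomial (Fin n × Fin n) k) • (A' v).map C).trace = 0 →
      (∀ (w : Fin n × Fin n) (a b : Fin N), A' w a b ≠ 0 →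
        (w.1 ∉ e.symm ((e univ).succAbove a) ∧ (w.2 : ℕ) = (e.symm ((e univ).succAbove a)).card) ∨
        (w.1 ∈ e.symm ((e ∅).succAbove b) ∧ (e.symm ((e ∅).succAbove b)).card = (w.2 : ℕ) + 1)) →
      ∀ (i j : Fin N) (v : Fin n × Fin n) (i' j' : Fin N) (v' : Fin n × Fin n),
      (v.1 ∉ e.symm ((e univ).succAbove i) ∧ (v.2 : ℕ) = (e.symm ((e univ).succAbove i)).card) →
      ¬ (v.1 ∈ e.symm ((e ∅).succAbove j) ∧ (e.symm ((e ∅).succAbove j)).card = (v.2 : ℕ) + 1) →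
      (v'.1 ∈ e.symm ((e ∅).succAbove j') ∧ (e.symm ((e ∅).succAbove j')).card = (v'.2 : ℕ) + 1) →
      ¬ (v'.1 ∉ e.symm ((e univ).succAbove i') ∧ (v'.2 : ℕ) = (e.symm ((e univ).succAbove i')).card) →
      insert v.1 (e.symm ((e univ).succAbove i)) = e.symm ((e univ).succAbove i') →
      e.symm ((e ∅).succAbove j) = (e.symm ((e ∅).succAbove j')).erase v'.1 →
      e.symm ((e ∅).succAbove j) ⊆ e.symm ((e univ).succAbove i') →
      A' v' i' j' = -A' v i j)
    (Λ' : Matrix (Fin N) (Fin N) k) (A' : Fin n × Fin n → Matrix (Fin N) (Fin N) k)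
    (htr : (((Matrix.of fun i j => coeff 0 (Grenet.repr k n e i j) : Matrix (Fin N) (Fin N) k).map
        (C : k →+* MvPolynomial (Fin n × Fin n) k) +
        ∑ v, (X v : MvPolynomial (Fin n × Fin n) k) •
          (Matrix.of fun i j => coeff (Finsupp.single v 1) (Grenet.repr k n e i j) : Matrix (Fin N) (Fin N) k).map C).adjugate
        * (Λ'.map C + ∑ v, (X v : MvPolynomial (Fin n × Fin n) k) • (A' v).map C)).trace = 0)
    (hC : ∀ v w, (Matrix.of fun i j => coeff (Finsupp.single v 1) (Grenet.repr k n e i j) : Matrix (Fin N) (Fin N) k).mulVec w = 0 →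
      ∃ u, (A' v).mulVec w = (Matrix.of fun i j => coeff (Finsupp.single v 1) (Grenet.repr k n e i j) : Matrix (Fin N) (Fin N) k).mulVec u)
    (h3 : ∃ P Q : Matrix (Fin N) (Fin N) k, P.trace = Q.trace ∧
      Λ' = P * (Matrix.of fun i j => coeff 0 (Grenet.repr k n e i j) : Matrix (Fin N) (Fin N) k) - (Matrix.of fun i j => coeff 0 (Grenet.repr k n e i j) : Matrix (Fin N) (Fin N) k) * Q) :
    ∃ P Q : Matrix (Fin N) (Fin N) k,
      Λ' = P * (Matrix.of fun i j => coeff 0 (Grenet.repr k n e i j) : Matrix (Fin N) (Fin N) k) - (Matrix.of fun i j => coeff 0 (Grenet.repr k n e i j) : Matrix (Fin N) (Fin N) k) * Q ∧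
      ∀ v, A' v = P * (Matrix.of fun i j => coeff (Finsupp.single v 1) (Grenet.repr k n e i j) : Matrix (Fin N) (Fin N) k) -
        (Matrix.of fun i j => coeff (Finsupp.single v 1) (Grenet.repr k n e i j) : Matrix (Fin N) (Fin N) k) * Q :=
  grenet_linearRigid_of_blockII e hn hN hII
    (fun A'' htr'' hsupp'' i j v i' v' ht hnh ht' hnh' hU hU' =>
      grenet_borderTu e hn hN A'' htr'' hsupp'' i j v i' v' ht hnh ht' hnh' hU hU')
    (fun A'' htr'' hsupp'' i j v j' v' hh hnt hh' hnt' h0 h0' =>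
      grenet_borderH0 e hn hN A'' htr'' hsupp'' i j v j' v' hh hnt hh' hnt' h0 h0')
    Λ' A' htr hC h3

end Summit.ValiantsHypothesis.Theorems.RigidityForcesSymmetry.GrenetGauge
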